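import Summits.QuantumFields.YangMills.Theorems.BalabanUVNodesN20CoreEdgeShellDialAscent

/-!
# BalabanUVNodes ∕ N20 (NE7b) — the `hedge`-JOINT COMPANION, module 13M: THE MASS PRICE OF THE ASCENT IS DOMINATED BY THE SUP PRICE PLUS N20's BAD MASS —
# module 13L's intra-class ℓ¹ deviation letter (Dev) FROM a two-run ratio-oscillation letter on the GOOD coarse classes (dag-n19-w1's decoupling ∕ `Fib` letter in ratio
# form) AND NE7b's `RelWeightBound` at the key-reading carriers; hence N21 at v5's pin from the window-key letters + the oscillation + N20's weight face — the
# JOINT use of the N19′∕N21 pair with N20's face that this seat was pointed at (the `hedge`-joint companion), now along the key dial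

Cell `pub-ymgap` (HUMAN RULING D-0062 Track A; D-0149 width push), seat `pub-ymgap-dag-n20-w3` (WIDTH SEAT 3 of 3 on NODE n20 = NE7b) gen 6, CLAIM-3 ∕ INTENT-3
(pub-ymgap INBOX l.31902).  Filed `--kind proof --supports stmt-QuantumFields-20544 --as helper` (K3⁷ `SpineGivenEndpointR13SepCoPH`; skeleton v5 941dddb108cbaacf);
COUNT-NEUTRAL.
ADDITIVE — imports this lineage's module 13L `…N20CoreEdgeShellDialAscent` (gen 6, p617153: `shellWeightBound_crOfRecord₁₃VAt_optShell_of_keyReading_of_fibreDev`; through it module 13 p608626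
`shellWeightBound_crOfRecord₁₃VAt_optShell_of_l1Mismatch` and dag-n20-d's K edition ∕ KTower: `classSetK₁₃`, `weightAK₁₃ ∕ weightBK₁₃`, `badClassK₁₃`, `kr_mem_classSetK₁₃`,
`badClassK₁₃_subset`, `sum_weightAK₁₃_eq ∕ sum_bad_weightAK₁₃_eq` and the B twins); node U5d's `fiberSum` ∕ `classVal`; the tree's `T4WeightBudget.RelWeightBound` (N20's shape)
BY NAME; modifies nothing.  [III] = [Balaban1988Convergent], [LF-I∕II] = [Balaban1989LargeFieldI∕II], [King1986] = CMP 102.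

WHY.  Modules 13K ∕ 13L bracket the located two-run content of stub 2's (N19′, N21) pair along every key reading `kr`: `letter(kr) ≤ letter(pin) ≤ letter(kr) + Dev(kr)`,
with `Dev(kr) = Σ_x (A_x − (A_u∕B_u)·B_x)⁺` (and the B twin) the intra-`kr`-class one-sided ℓ¹ deviation, `u = kr x`.  The window road's natural currency for «old structure
is forgotten inside a window class» is dag-n19-w1's DECOUPLING letter (p610409 (D), `…N19RekeyingAscent` §4 `Fib` ⟺ intra-fibre OSCILLATION of the two-run log-ratio
`≤ 2·vol·ε_K`, a sup over each fibre), and N20's weight face books the classes where no such control is expected.  THIS FILE shows that these two together PAY (Dev):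
* §1 [folklore] abstract.  Ratio oscillation on a fibre, `p s·q s′ ≤ M·p s′·q s` for all `s, s′` in the fibre (`M ≥ 1`; = the log form with `M = e^{2volε}`,
  `ratioOsc_of_logOsc`), summed over `s′` gives `p s·Q_τ ≤ M·P_τ·q s`, i.e. `(P_τ∕Q_τ)·q s ≥ p s∕M` when `Q_τ > 0`, hence `(p s − (P_τ∕Q_τ) q s)⁺ ≤ (1 − M⁻¹)·p s`
  (`posPart_dev_le_of_ratioOsc`) and ★ `fibreDev_le_of_ratioOsc`: the deviation on a GOOD fibre is `≤ (1 − M⁻¹)·P_τ`; on ANY fibre it is `≤ P_τ` (`fibreDev_le_fiberSum`);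
  so ★★ `sum_fibreDev_le_of_ratioOsc`: `Dev ≤ (1 − M⁻¹)·Σ_S p + (mass of p on the BAD classes)`, and with a bad-mass fraction `W` ★★ `fibreDev_le_of_ratioOsc_of_badMass`:
  deviation fraction `≤ (1 − M⁻¹) + W`.  The mass price is WEAKER than the sup price: one term of tiny mass and wild ratio has oscillation `M ≫ 1` and deviation `≈ 0`.
* §2 at the record (dag-n20-d's K edition; every key reading `kr`, bad reading `bd`, tuple with core provisos, `g₀`, `os`): ★★★ `fibreDevA∕B_record_le_of_ratioOsc_of_relWeightBound`
  — (Dev) for run A (resp. B) with fraction `(1 − M⁻¹) + W K` FROM the ratio oscillation `≤ M` inside the GOOD `kr`-classes, positivity of the other run's coarse weight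
  there, and `RelWeightBound 1 (classSetK₁₃ kr) (weightAK₁₃ kr) (weightBK₁₃ kr) (badClassK₁₃ kr bd) W` (N20's face at the key reading, dag-n20-w2's object) — and
  ★★★ `shellWeightBound_crOfRecord₁₃VAt_optShell_of_keyReading_of_ratioOsc_of_relWeightBound`: N21 AT v5's PINNED READING `crOfRecord₁₃VAt K₀ jcut sh⋆` FROM (W) the two
  ℓ¹ letters at the key reading (fraction `w`), (Osc) ratio oscillation `M_K` on the good `kr`-classes with `Σ (1 − M_K⁻¹) < ∞`, positivity of both coarse weights there, and
  (N20) `RelWeightBound … W` at the key-reading carriers — fraction `w + (1 − M⁻¹) + W` (module 13L ∘ module 13); N19′ there outright, N20 at the PIN free at `jcut = 0`.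
LOCATED (for plan g84 ∕ idea-3 ∕ the n19∕n20 lanes; said, not decided): in the ℓ¹ currency the window road serves stub 2's (N19′, N21) pair at v5's PIN from THREE letters
at the WINDOW key — (W) class-mismatch modulo constants of the window-class weights, (Osc) two-run ratio oscillation inside the GOOD window classes (dag-n19-w1's (D)), and
N20's `RelWeightBound` for the window's BAD classes (over-aged regions, the card's (AC)) — each summable; this is the division of labour the crux card describes («weights for
the rare huge regions, `Core` for everything young»), priced additively, with the key-reading pin's N20 face USED (not idle) exactly on the classes exempted from (Osc).  Nothing
here decides (LS)∕(N) at the record; first-level saturation would enter through `W`.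

HONEST FRAMING.  [folklore] finite-sum ∕ `max` ∕ `exp` arithmetic over node U5d's `fiberSum` ∕ `classVal` and the tree's SHAPES (`RelWeightBound`, `ShellWeightBound`),
dag-n20-d's K edition and this lineage's modules 13 ∕ 13L BY NAME; count-neutral; proves NO estimate of the programme: (W), (Osc), the positivity rows and the `RelWeightBound`
witness are HYPOTHESES, inhabited for no Bałaban family today (A2 declared) — two-run ∕ NE7b statements NOT PRINTED for `d = 4`, NOT proved.  Nothing of Bałaban's asserted;
no `Provisos₁₃CoPH` inhabitant claimed (K0⁷ OPEN); NE7 ∕ NE7b ∕ NE7c NOT PRINTED ∕ NOT PROVED; N19 ∕ N20 ∕ N21 NOT discharged; K3⁷ NOT closed, not claimed, v5 STANDS;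
counts unmoved (typed 28∕28 · discharged 5∕28); no count claim.  One finite `𝕋⁴_{L^K}` programme at fixed `ε = L^{−K}`, Bałaban AS PRINTED; the YM mass gap (Clay) is
NOT proved by any of this — R4 closes the conditional finite-𝕋⁴ rung `BalabanLadder.UV` only; NOT ℝ⁴, NOT continuum, NOT OS.  No `def`, no `instance`, no `notation`,
no `sorry`, no private decls.  Sources (location only): [King1986] (3.10)–(3.13) pp.656–657; [LF-II] Thm 1 + (0.1) pp.355–356, (1.80) p.384; [III] (2.18) p.257, p.244.
v1.1 (APPEND-ONLY, INTENT-4): §3 — the `hMs` ∕ `hM` rows of §2's composition from a summable log-oscillation radius, in particular from module 12's window budget.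
-/

noncomputable section

open Finset
open scoped BigOperators

namespace Summit.QuantumFields.YangMills.BalabanUVNodes.N20CoreEdgeShellDialAscentFromOscillation

open Literature.MathematicalPhysics.QuantumFieldTheory.Balaban1983to89
open Literature.MathematicalPhysics.QuantumFieldTheory.Balaban1983to89.T4Continuum
open Literature.MathematicalPhysics.QuantumFieldTheory.Balaban1983to89.Node00
open T4WeightBudget (RelWeightBound)
open T4IndicatorShell (ShellWeightBound)
open T4MatchingAssembly (classVal sum_classVal classVal_nonneg)
open T4HybridMatching (fiberSum sum_fiberSum fiberSum_nonneg)
open Summit.QuantumFields.BalabanUV.T4Continuum.Spine YMDAG.UVSplit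
open Summit.QuantumFields.YangMills.BalabanUVNodes.N21KeyedShellWeightShellZero (weightA₁₃_nonneg weightB₁₃_nonneg)
open Summit.QuantumFields.YangMills.BalabanUVNodes.N20CoreEdgeShellDial
open Summit.QuantumFields.YangMills.BalabanUVNodes.N20CoreEdgeShellDialAscent

/-! ## §1 Abstract: ratio oscillation on the good fibres + the bad mass dominate the intra-class ℓ¹ deviation -/

section Fibre

variable {σ ι : Type*} [DecidableEq ι]

/-- Summing the cross-ratio oscillation over one fibre: `p s · Q_τ ≤ M · P_τ · q s` (`P_τ, Q_τ` the fibre sums). [folklore] -/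
theorem mul_fiberSum_le_of_ratioOsc (S : Finset σ) (π : σ → ι) (p q : σ → ℝ) (M : ℝ) (τ : ι) {s : σ}
    (hs : s ∈ S.filter (fun s => π s = τ))
    (hosc : ∀ s ∈ S.filter (fun s => π s = τ), ∀ s' ∈ S.filter (fun s => π s = τ), p s * q s' ≤ M * (p s' * q s)) :
    p s * fiberSum S π q τ ≤ M * fiberSum S π p τ * q s := by
  unfold fiberSum
  rw [Finset.mul_sum, Finset.mul_sum, Finset.sum_mul]
  refine Finset.sum_le_sum fun s' hs' => ?_
  rw [mul_assoc]
  exact hosc s hs s' hs'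

/-- Pointwise on a GOOD fibre (`Q_τ > 0`, `M ≥ 1`, `p s ≥ 0`): `(p s − (P_τ∕Q_τ)·q s)⁺ ≤ (1 − M⁻¹)·p s` — the class ratio times `q s` is at least `p s ∕ M`. [folklore] -/
theorem posPart_dev_le_of_ratioOsc (S : Finset σ) (π : σ → ι) (p q : σ → ℝ) {M : ℝ} (hM : 1 ≤ M) (τ : ι) {s : σ}
    (hs : s ∈ S.filter (fun s => π s = τ)) (hps : 0 ≤ p s) (hQ : 0 < fiberSum S π q τ)
    (hosc : ∀ s ∈ S.filter (fun s => π s = τ), ∀ s' ∈ S.filter (fun s => π s = τ), p s * q s' ≤ M * (p s' * q s)) :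
    max 0 (p s - fiberSum S π p τ / fiberSum S π q τ * q s) ≤ (1 - M⁻¹) * p s := by
  have hM0 : 0 < M := lt_of_lt_of_le one_pos hM
  have hkey := mul_fiberSum_le_of_ratioOsc S π p q M τ hs hosc
  have h1 : M⁻¹ * p s ≤ fiberSum S π p τ / fiberSum S π q τ * q s := by
    rw [inv_mul_le_iff₀ hM0, div_mul_eq_mul_div, ← mul_div_assoc, le_div_iff₀ hQ, ← mul_assoc]
    exact hkey
  refine max_le (mul_nonneg (sub_nonneg.mpr (inv_le_one_of_one_le₀ hM)) hps) ?_
  have h2 : (1 - M⁻¹) * p s = p s - M⁻¹ * p s := by ring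
  linarith

/-- **★ ON ONE GOOD FIBRE the one-sided ℓ¹ deviation of `p` from `(P_τ∕Q_τ)·q` is `≤ (1 − M⁻¹)·P_τ`.** [folklore] -/
theorem fibreDev_le_of_ratioOsc (S : Finset σ) (π : σ → ι) (p q : σ → ℝ) {M : ℝ} (hM : 1 ≤ M) (τ : ι)
    (hp : ∀ s ∈ S, 0 ≤ p s) (hQ : 0 < fiberSum S π q τ)
    (hosc : ∀ s ∈ S.filter (fun s => π s = τ), ∀ s' ∈ S.filter (fun s => π s = τ), p s * q s' ≤ M * (p s' * q s)) :
    fiberSum S π (fun s => max 0 (p s - fiberSum S π p (π s) / fiberSum S π q (π s) * q s)) τ ≤ (1 - M⁻¹) * fiberSum S π p τ := by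
  unfold fiberSum
  rw [Finset.mul_sum]
  refine Finset.sum_le_sum fun s hs => ?_
  have hπ : π s = τ := (Finset.mem_filter.mp hs).2
  rw [hπ]
  exact posPart_dev_le_of_ratioOsc S π p q hM τ hs (hp s (Finset.mem_filter.mp hs).1) hQ hosc

/-- On ANY fibre with non-negative weights the deviation is `≤ P_τ` (the subtracted ratio term is non-negative) — what a BAD class costs at most. [folklore] -/
theorem fibreDev_le_fiberSum (S : Finset σ) (π : σ → ι) (p q : σ → ℝ) (τ : ι) (hp : ∀ s ∈ S, 0 ≤ p s) (hq : ∀ s ∈ S, 0 ≤ q s) :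
    fiberSum S π (fun s => max 0 (p s - fiberSum S π p (π s) / fiberSum S π q (π s) * q s)) τ ≤ fiberSum S π p τ := by
  unfold fiberSum
  refine Finset.sum_le_sum fun s hs => max_le (hp s (Finset.mem_filter.mp hs).1) (sub_le_self _ (mul_nonneg (div_nonneg ?_ ?_) (hq s (Finset.mem_filter.mp hs).1)))
  · exact Finset.sum_nonneg fun s' hs' => hp s' (Finset.mem_filter.mp hs').1
  · exact Finset.sum_nonneg fun s' hs' => hq s' (Finset.mem_filter.mp hs').1

/-- The fibre sums over a set `G` of classes are the terms whose class lies in `G` (node U5d's `T4MatchingAssembly.sum_classVal_eq_filter`, one slice). [folklore] -/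
theorem sum_fiberSum_eq_sum_filter (S : Finset σ) (π : σ → ι) (b : σ → ℝ) (G : Finset ι) :
    ∑ τ ∈ G, fiberSum S π b τ = ∑ s ∈ S.filter (fun s => π s ∈ G), b s := by
  unfold fiberSum
  rw [← Finset.sum_fiberwise_of_maps_to (s := S.filter (fun s => π s ∈ G)) (t := G) (g := π)
    (fun s hs => (Finset.mem_filter.mp hs).2) b]
  refine Finset.sum_congr rfl fun τ hτ => Finset.sum_congr ?_ fun _ _ => rfl
  ext s
  simp only [Finset.mem_filter]
  constructor
  · rintro ⟨hs, hπ⟩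
    exact ⟨⟨hs, hπ ▸ hτ⟩, hπ⟩
  · rintro ⟨⟨hs, _⟩, hπ⟩
    exact ⟨hs, hπ⟩

/-- **★★ THE MASS PRICE IS DOMINATED BY THE SUP PRICE PLUS THE BAD MASS**: non-negative weights, a bad class `Bad ⊆ T`, positive reference fibre sums and two-run ratio
oscillation `≤ M` (`M ≥ 1`) on the GOOD fibres ⇒ `Σ_S (p − (P∕Q)(π s)·q)⁺ ≤ (1 − M⁻¹)·Σ_S p + Σ_{s : π s ∈ Bad} p` — module 13L's deviation is at most the oscillation defect of
the good mass plus the whole bad mass. [folklore] -/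
theorem sum_fibreDev_le_of_ratioOsc {S : Finset σ} {T Bad : Finset ι} {π : σ → ι} (p q : σ → ℝ) {M : ℝ} (hM : 1 ≤ M)
    (hmaps : ∀ s ∈ S, π s ∈ T) (hBad : Bad ⊆ T) (hp : ∀ s ∈ S, 0 ≤ p s) (hq : ∀ s ∈ S, 0 ≤ q s)
    (hQ : ∀ τ ∈ T \ Bad, 0 < fiberSum S π q τ)
    (hosc : ∀ τ ∈ T \ Bad, ∀ s ∈ S.filter (fun s => π s = τ), ∀ s' ∈ S.filter (fun s => π s = τ), p s * q s' ≤ M * (p s' * q s)) :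
    ∑ s ∈ S, max 0 (p s - fiberSum S π p (π s) / fiberSum S π q (π s) * q s) ≤
      (1 - M⁻¹) * ∑ s ∈ S, p s + ∑ s ∈ S.filter (fun s => π s ∈ Bad), p s := by
  have hM1 : 0 ≤ 1 - M⁻¹ := sub_nonneg.mpr (inv_le_one_of_one_le₀ hM)
  rw [← sum_fiberSum (fun s => max 0 (p s - fiberSum S π p (π s) / fiberSum S π q (π s) * q s)) hmaps, ← sum_fiberSum p hmaps,
    ← Finset.sum_sdiff hBad, ← sum_fiberSum_eq_sum_filter S π p Bad]
  have hbad : ∑ τ ∈ Bad, fiberSum S π (fun s => max 0 (p s - fiberSum S π p (π s) / fiberSum S π q (π s) * q s)) τ ≤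
      ∑ τ ∈ Bad, fiberSum S π p τ := Finset.sum_le_sum fun τ _ => fibreDev_le_fiberSum S π p q τ hp hq
  have hgood : ∑ τ ∈ T \ Bad, fiberSum S π (fun s => max 0 (p s - fiberSum S π p (π s) / fiberSum S π q (π s) * q s)) τ ≤
      (1 - M⁻¹) * ∑ τ ∈ T \ Bad, fiberSum S π p τ := by
    rw [Finset.mul_sum]
    exact Finset.sum_le_sum fun τ hτ => fibreDev_le_of_ratioOsc S π p q hM τ hp (hQ τ hτ) (hosc τ hτ)
  have hsub : (1 - M⁻¹) * ∑ τ ∈ T \ Bad, fiberSum S π p τ ≤ (1 - M⁻¹) * ∑ τ ∈ T, fiberSum S π p τ :=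
    mul_le_mul_of_nonneg_left (Finset.sum_le_sum_of_subset_of_nonneg Finset.sdiff_subset fun τ _ _ => fiberSum_nonneg hp τ) hM1
  linarith

/-- **FROM THE LOG-RATIO OSCILLATION TO THE CROSS-RATIO FORM** (positive weights): `(log b − log a) − (log b′ − log a′) ≤ L ⇒ b·a′ ≤ e^{L}·(b′·a)` — dag-n19-w1's
`hosc` binder of `…N19RekeyingAscent.fibrewise_of_fibreOsc` (pairwise log-ratio oscillation `≤ 2·vol·ε_K` on a fibre) thus gives the ratio oscillation below with
`M := e^{2·vol·ε_K}`, `1 − M⁻¹ ≤ 2·vol·ε_K`. [folklore] -/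
theorem ratioOsc_of_logOsc {a b a' b' L : ℝ} (ha : 0 < a) (hb : 0 < b) (ha' : 0 < a') (hb' : 0 < b')
    (h : (Real.log b - Real.log a) - (Real.log b' - Real.log a') ≤ L) : b * a' ≤ Real.exp L * (b' * a) :=
  calc b * a' = Real.exp (Real.log b + Real.log a') := by rw [Real.exp_add, Real.exp_log hb, Real.exp_log ha']
    _ ≤ Real.exp (L + (Real.log b' + Real.log a)) := Real.exp_le_exp.mpr (by linarith)
    _ = Real.exp L * (b' * a) := by rw [Real.exp_add, Real.exp_add, Real.exp_log hb', Real.exp_log ha]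

variable {S : ℕ → Finset σ} {T : ℕ → Finset ι} {π : ℕ → σ → ι}

/-- **★★ MODULE 13L's DEVIATION LETTER FROM THE RATIO OSCILLATION AND THE BAD-MASS LETTER** (spine currency `K`, `t`; run-generic `(p, q)`): ratio oscillation `≤ M` on
the good fibres, positive reference class values there, bad mass fraction `≤ W` ⇒ deviation fraction `≤ (1 − M⁻¹) + W`. [folklore] -/
theorem fibreDev_le_of_ratioOsc_of_badMass {Bad : ℕ → ℝ → Finset ι} (hmaps : ∀ K, ∀ s ∈ S K, π K s ∈ T K)
    {p q : ℕ → ℝ → σ → ℝ} {M W : ℝ} {K : ℕ} {t : ℝ} (hM : 1 ≤ M) (hBad : Bad K t ⊆ T K)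
    (hp : ∀ s ∈ S K, 0 ≤ p K t s) (hq : ∀ s ∈ S K, 0 ≤ q K t s)
    (hQ : ∀ τ ∈ T K \ Bad K t, 0 < classVal S π q K t τ)
    (hosc : ∀ τ ∈ T K \ Bad K t, ∀ s ∈ (S K).filter (fun s => π K s = τ), ∀ s' ∈ (S K).filter (fun s => π K s = τ),
      p K t s * q K t s' ≤ M * (p K t s' * q K t s))
    (hbad : ∑ s ∈ (S K).filter (fun s => π K s ∈ Bad K t), p K t s ≤ W * ∑ s ∈ S K, p K t s) :
    ∑ s ∈ S K, max 0 (p K t s - classVal S π p K t (π K s) / classVal S π q K t (π K s) * q K t s) ≤ ((1 - M⁻¹) + W) * ∑ s ∈ S K, p K t s := by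
  have h := sum_fibreDev_le_of_ratioOsc (π := π K) (p K t) (q K t) hM (hmaps K) hBad hp hq hQ hosc
  unfold classVal
  rw [add_mul]
  exact h.trans (add_le_add le_rfl hbad)

end Fibre

/-! ### §1b Toy: the mass price can be MUCH smaller than the sup price (one class, two terms: `p = (1, 1∕10)`, `q = (1, 1∕100)`) -/

section Toy

/-- TOY: one class with a heavy matched term `(p, q) = (1, 1)` and a light wild one `(1∕10, 1∕100)`.  The least ratio-oscillation constant is `M = 10` (the wild term's
ratio is ten times the heavy one's), so §1's sup-type bound is `(1 − M⁻¹)·P = (9∕10)·(11∕10) = 99∕100`; the actual one-sided ℓ¹ deviation of `p` from `(P∕Q)·q`,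
`P∕Q = (11∕10)∕(101∕100) = 110∕101`, is `(1 − 110∕101)⁺ + (1∕10 − (110∕101)(1∕100))⁺ = 0 + 9∕101` — eleven times smaller: the mass currency forgives light wild terms. [folklore] -/
theorem toy_massPrice_lt_supPrice :
    max 0 ((1 : ℝ) - (11 / 10) / (101 / 100) * 1) + max 0 ((1 : ℝ) / 10 - (11 / 10) / (101 / 100) * (1 / 100)) = 9 / 101 ∧
    (1 - (10 : ℝ)⁻¹) * (11 / 10) = 99 / 100 ∧ (9 : ℝ) / 101 < 99 / 100 := by
  refine ⟨?_, by norm_num, by norm_num⟩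
  rw [max_eq_left (by norm_num : (1 : ℝ) - (11 / 10) / (101 / 100) * 1 ≤ 0), max_eq_right (by norm_num : (0 : ℝ) ≤ 1 / 10 - (11 / 10) / (101 / 100) * (1 / 100))]
  norm_num

end Toy

section Record

variable {F : T4Family} {N : ℕ} [NeZero N] (K₀ : ℕ) (kr : KeyReading₁₃ N K₀) (bd : BadKeyReading₁₃ N K₀) (θ : Stage13HParams F N)
  (hP : θ.Provisos₁₃CoPH F N) (g₀ : ℕ → ℝ) (os : List (ULoop F))

/-- **★★★ AT THE RECORD, run A**: module 13L's intra-`kr`-class deviation letter for `weightA₁₃` against `(weightAK₁₃∕weightBK₁₃)(kr x)·weightB₁₃` FROM (i) the two-run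
RATIO OSCILLATION `≤ M` inside every GOOD coarse class (`weightA₁₃ x·weightB₁₃ x′ ≤ M·weightA₁₃ x′·weightB₁₃ x` for `x, x′` in the same `kr`-class — dag-n19-w1's decoupling
letter in ratio form), (ii) positive run-B coarse weight on the good coarse classes, (iii) N20's `RelWeightBound` AT THE KEY-READING CARRIERS (dag-n20-w2's face object; its
`bad_left` through n20-d's `sum_bad_weightAK₁₃_eq`): fraction `(1 − M⁻¹) + W K`.  The three hypotheses are two-run ∕ NE7b content — NOT PRINTED for `d = 4`, NOT proved.
[cite: Balaban1989LargeFieldII, Thm 1 + (0.1) pp.355–356, (1.80) p.384 (templates only)] [bookkeeping] -/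
theorem fibreDevA_record_le_of_ratioOsc_of_relWeightBound {W : ℕ → ℝ} {M : ℝ} (hM : 1 ≤ M) {K : ℕ} {t : ℝ} (ht : |t| ≤ 1)
    (hW : RelWeightBound 1 (classSetK₁₃ θ K₀ g₀ (kr F θ hP g₀ os)) (weightAK₁₃ θ hP K₀ g₀ os (kr F θ hP g₀ os)) (weightBK₁₃ θ hP K₀ g₀ os (kr F θ hP g₀ os))
      (badClassK₁₃ θ K₀ g₀ (kr F θ hP g₀ os) (bd F θ hP g₀ os)) W)
    (hBpos : letI : ∀ Kc, DecidableEq (SiteSeqKey F Kc) := fun _ => Classical.decEq _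
      ∀ u ∈ classSetK₁₃ θ K₀ g₀ (kr F θ hP g₀ os) K \ badClassK₁₃ θ K₀ g₀ (kr F θ hP g₀ os) (bd F θ hP g₀ os) K t,
      0 < weightBK₁₃ θ hP K₀ g₀ os (kr F θ hP g₀ os) K t u)
    (hosc : letI : ∀ Kc, DecidableEq (SiteSeqKey F Kc) := fun _ => Classical.decEq _
      ∀ u ∈ classSetK₁₃ θ K₀ g₀ (kr F θ hP g₀ os) K \ badClassK₁₃ θ K₀ g₀ (kr F θ hP g₀ os) (bd F θ hP g₀ os) K t,
      ∀ x ∈ (classSet₁₃ θ K₀ g₀ K).filter (fun x => kr F θ hP g₀ os K x = u), ∀ x' ∈ (classSet₁₃ θ K₀ g₀ K).filter (fun x => kr F θ hP g₀ os K x = u),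
        weightA₁₃ θ hP K₀ g₀ os K t x * weightB₁₃ θ hP K₀ g₀ os K t x' ≤ M * (weightA₁₃ θ hP K₀ g₀ os K t x' * weightB₁₃ θ hP K₀ g₀ os K t x)) :
    ∑ x ∈ classSet₁₃ θ K₀ g₀ K, max 0 (weightA₁₃ θ hP K₀ g₀ os K t x -
        weightAK₁₃ θ hP K₀ g₀ os (kr F θ hP g₀ os) K t (kr F θ hP g₀ os K x) / weightBK₁₃ θ hP K₀ g₀ os (kr F θ hP g₀ os) K t (kr F θ hP g₀ os K x) *
          weightB₁₃ θ hP K₀ g₀ os K t x)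
      ≤ ((1 - M⁻¹) + W K) * ∑ x ∈ classSet₁₃ θ K₀ g₀ K, weightA₁₃ θ hP K₀ g₀ os K t x := by
  letI : ∀ Kc, DecidableEq (SiteSeqKey F Kc) := fun _ => Classical.decEq _
  have hbad := hW.bad_left K t ht
  rw [sum_bad_weightAK₁₃_eq θ hP K₀ g₀ os (kr F θ hP g₀ os) (bd F θ hP g₀ os) K t, sum_weightAK₁₃_eq θ hP K₀ g₀ os (kr F θ hP g₀ os) K t] at hbad
  exact fibreDev_le_of_ratioOsc_of_badMass (S := classSet₁₃ θ K₀ g₀) (T := classSetK₁₃ θ K₀ g₀ (kr F θ hP g₀ os)) (π := kr F θ hP g₀ os)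
    (Bad := badClassK₁₃ θ K₀ g₀ (kr F θ hP g₀ os) (bd F θ hP g₀ os)) (p := weightA₁₃ θ hP K₀ g₀ os) (q := weightB₁₃ θ hP K₀ g₀ os)
    (fun K x hx => kr_mem_classSetK₁₃ θ K₀ g₀ (kr F θ hP g₀ os) hx) hM (badClassK₁₃_subset θ K₀ g₀ (kr F θ hP g₀ os) (bd F θ hP g₀ os) K t)
    (fun x _ => weightA₁₃_nonneg F θ hP K₀ g₀ os K t x) (fun x _ => weightB₁₃_nonneg F θ hP K₀ g₀ os K t x) hBpos hosc hbad

/-- **★★★ AT THE RECORD, run B** (`weightB₁₃` against `(weightBK₁₃∕weightAK₁₃)(kr x)·weightA₁₃`; positive run-A coarse weight on the good classes; `bad_right`).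
[cite: Balaban1989LargeFieldII, Thm 1 + (0.1) pp.355–356, (1.80) p.384 (templates only)] [bookkeeping] -/
theorem fibreDevB_record_le_of_ratioOsc_of_relWeightBound {W : ℕ → ℝ} {M : ℝ} (hM : 1 ≤ M) {K : ℕ} {t : ℝ} (ht : |t| ≤ 1)
    (hW : RelWeightBound 1 (classSetK₁₃ θ K₀ g₀ (kr F θ hP g₀ os)) (weightAK₁₃ θ hP K₀ g₀ os (kr F θ hP g₀ os)) (weightBK₁₃ θ hP K₀ g₀ os (kr F θ hP g₀ os))
      (badClassK₁₃ θ K₀ g₀ (kr F θ hP g₀ os) (bd F θ hP g₀ os)) W)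
    (hApos : letI : ∀ Kc, DecidableEq (SiteSeqKey F Kc) := fun _ => Classical.decEq _
      ∀ u ∈ classSetK₁₃ θ K₀ g₀ (kr F θ hP g₀ os) K \ badClassK₁₃ θ K₀ g₀ (kr F θ hP g₀ os) (bd F θ hP g₀ os) K t,
      0 < weightAK₁₃ θ hP K₀ g₀ os (kr F θ hP g₀ os) K t u)
    (hosc : letI : ∀ Kc, DecidableEq (SiteSeqKey F Kc) := fun _ => Classical.decEq _
      ∀ u ∈ classSetK₁₃ θ K₀ g₀ (kr F θ hP g₀ os) K \ badClassK₁₃ θ K₀ g₀ (kr F θ hP g₀ os) (bd F θ hP g₀ os) K t,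
      ∀ x ∈ (classSet₁₃ θ K₀ g₀ K).filter (fun x => kr F θ hP g₀ os K x = u), ∀ x' ∈ (classSet₁₃ θ K₀ g₀ K).filter (fun x => kr F θ hP g₀ os K x = u),
        weightB₁₃ θ hP K₀ g₀ os K t x * weightA₁₃ θ hP K₀ g₀ os K t x' ≤ M * (weightB₁₃ θ hP K₀ g₀ os K t x' * weightA₁₃ θ hP K₀ g₀ os K t x)) :
    ∑ x ∈ classSet₁₃ θ K₀ g₀ K, max 0 (weightB₁₃ θ hP K₀ g₀ os K t x -
        weightBK₁₃ θ hP K₀ g₀ os (kr F θ hP g₀ os) K t (kr F θ hP g₀ os K x) / weightAK₁₃ θ hP K₀ g₀ os (kr F θ hP g₀ os) K t (kr F θ hP g₀ os K x) *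
          weightA₁₃ θ hP K₀ g₀ os K t x)
      ≤ ((1 - M⁻¹) + W K) * ∑ x ∈ classSet₁₃ θ K₀ g₀ K, weightB₁₃ θ hP K₀ g₀ os K t x := by
  letI : ∀ Kc, DecidableEq (SiteSeqKey F Kc) := fun _ => Classical.decEq _
  have hbad := hW.bad_right K t ht
  rw [sum_bad_weightBK₁₃_eq θ hP K₀ g₀ os (kr F θ hP g₀ os) (bd F θ hP g₀ os) K t, sum_weightBK₁₃_eq θ hP K₀ g₀ os (kr F θ hP g₀ os) K t] at hbad
  exact fibreDev_le_of_ratioOsc_of_badMass (S := classSet₁₃ θ K₀ g₀) (T := classSetK₁₃ θ K₀ g₀ (kr F θ hP g₀ os)) (π := kr F θ hP g₀ os)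
    (Bad := badClassK₁₃ θ K₀ g₀ (kr F θ hP g₀ os) (bd F θ hP g₀ os)) (p := weightB₁₃ θ hP K₀ g₀ os) (q := weightA₁₃ θ hP K₀ g₀ os)
    (fun K x hx => kr_mem_classSetK₁₃ θ K₀ g₀ (kr F θ hP g₀ os) hx) hM (badClassK₁₃_subset θ K₀ g₀ (kr F θ hP g₀ os) (bd F θ hP g₀ os) K t)
    (fun x _ => weightB₁₃_nonneg F θ hP K₀ g₀ os K t x) (fun x _ => weightA₁₃_nonneg F θ hP K₀ g₀ os K t x) hApos hosc hbad


variable (jcut : ℕ → ℕ) (sh : ShellSplit₁₃CoPH N K₀) (c : ℕ → ℝ)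

/-- **★★★ N21 AT v5's PINNED READING FROM THE WINDOW-KEY LETTERS, THE RATIO OSCILLATION ON THE GOOD CLASSES AND N20's WEIGHT FACE AT THE KEY READING** (module 13L's
`shellWeightBound_crOfRecord₁₃VAt_optShell_of_keyReading_of_fibreDev` with (Dev) discharged by §2): `sh⋆` = module 13's optimal split of the FINE weights at constants `c`;
(W) the two ℓ¹ letters of the `kr`-COARSE weights with summable fraction `w ≥ 0`; (Osc) two-run ratio oscillation `≤ M K` (`1 ≤ M K`, `Σ (1 − (M K)⁻¹) < ∞`) inside every
GOOD `kr`-class, both coarse weights positive there; (N20) `RelWeightBound` at the key-reading carriers with `W` ⇒ `ShellWeightBound` at `crOfRecord₁₃VAt K₀ jcut sh⋆`, canonical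
`Wsh`, fraction `w + (1 − M⁻¹) + W`.  Every hypothesis is two-run ∕ NE7b content — NOT PRINTED for `d = 4`, NOT proved.
[cite: Balaban1989LargeFieldII, Thm 1 + (0.1) pp.355–356, (1.80) p.384; King1986, (3.10)–(3.13) pp.656–657 (templates only)] [bookkeeping] -/
theorem shellWeightBound_crOfRecord₁₃VAt_optShell_of_keyReading_of_ratioOsc_of_relWeightBound {w W : ℕ → ℝ} {M : ℕ → ℝ}
    (hsh : sh F θ hP g₀ os =
      (fun K t x => max 0 (weightA₁₃ θ hP K₀ g₀ os K t x - Real.exp (-c K) * weightB₁₃ θ hP K₀ g₀ os K t x),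
       fun K t x => max 0 (weightB₁₃ θ hP K₀ g₀ os K t x - Real.exp (c K) * weightA₁₃ θ hP K₀ g₀ os K t x)))
    (hw0 : ∀ K, 0 ≤ w K) (hws : Summable w) (hM : ∀ K, 1 ≤ M K) (hMs : Summable fun K => 1 - (M K)⁻¹)
    (hW : RelWeightBound 1 (classSetK₁₃ θ K₀ g₀ (kr F θ hP g₀ os)) (weightAK₁₃ θ hP K₀ g₀ os (kr F θ hP g₀ os)) (weightBK₁₃ θ hP K₀ g₀ os (kr F θ hP g₀ os))
      (badClassK₁₃ θ K₀ g₀ (kr F θ hP g₀ os) (bd F θ hP g₀ os)) W)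
    (hmA : ∀ (K : ℕ) (t : ℝ), |t| ≤ 1 →
      ∑ u ∈ classSetK₁₃ θ K₀ g₀ (kr F θ hP g₀ os) K,
          max 0 (weightAK₁₃ θ hP K₀ g₀ os (kr F θ hP g₀ os) K t u - Real.exp (-c K) * weightBK₁₃ θ hP K₀ g₀ os (kr F θ hP g₀ os) K t u)
        ≤ w K * ∑ u ∈ classSetK₁₃ θ K₀ g₀ (kr F θ hP g₀ os) K, weightAK₁₃ θ hP K₀ g₀ os (kr F θ hP g₀ os) K t u)
    (hmB : ∀ (K : ℕ) (t : ℝ), |t| ≤ 1 →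
      ∑ u ∈ classSetK₁₃ θ K₀ g₀ (kr F θ hP g₀ os) K,
          max 0 (weightBK₁₃ θ hP K₀ g₀ os (kr F θ hP g₀ os) K t u - Real.exp (c K) * weightAK₁₃ θ hP K₀ g₀ os (kr F θ hP g₀ os) K t u)
        ≤ w K * ∑ u ∈ classSetK₁₃ θ K₀ g₀ (kr F θ hP g₀ os) K, weightBK₁₃ θ hP K₀ g₀ os (kr F θ hP g₀ os) K t u)
    (hApos : letI : ∀ Kc, DecidableEq (SiteSeqKey F Kc) := fun _ => Classical.decEq _
      ∀ (K : ℕ) (t : ℝ), |t| ≤ 1 → ∀ u ∈ classSetK₁₃ θ K₀ g₀ (kr F θ hP g₀ os) K \ badClassK₁₃ θ K₀ g₀ (kr F θ hP g₀ os) (bd F θ hP g₀ os) K t,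
        0 < weightAK₁₃ θ hP K₀ g₀ os (kr F θ hP g₀ os) K t u)
    (hBpos : letI : ∀ Kc, DecidableEq (SiteSeqKey F Kc) := fun _ => Classical.decEq _
      ∀ (K : ℕ) (t : ℝ), |t| ≤ 1 → ∀ u ∈ classSetK₁₃ θ K₀ g₀ (kr F θ hP g₀ os) K \ badClassK₁₃ θ K₀ g₀ (kr F θ hP g₀ os) (bd F θ hP g₀ os) K t,
        0 < weightBK₁₃ θ hP K₀ g₀ os (kr F θ hP g₀ os) K t u)
    (hosc : letI : ∀ Kc, DecidableEq (SiteSeqKey F Kc) := fun _ => Classical.decEq _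
      ∀ (K : ℕ) (t : ℝ), |t| ≤ 1 → ∀ u ∈ classSetK₁₃ θ K₀ g₀ (kr F θ hP g₀ os) K \ badClassK₁₃ θ K₀ g₀ (kr F θ hP g₀ os) (bd F θ hP g₀ os) K t,
        ∀ x ∈ (classSet₁₃ θ K₀ g₀ K).filter (fun x => kr F θ hP g₀ os K x = u), ∀ x' ∈ (classSet₁₃ θ K₀ g₀ K).filter (fun x => kr F θ hP g₀ os K x = u),
          weightA₁₃ θ hP K₀ g₀ os K t x * weightB₁₃ θ hP K₀ g₀ os K t x' ≤ M K * (weightA₁₃ θ hP K₀ g₀ os K t x' * weightB₁₃ θ hP K₀ g₀ os K t x)) :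
    ShellWeightBound (crOfRecord₁₃VAt K₀ jcut sh F θ hP g₀ os).l₀ (crOfRecord₁₃VAt K₀ jcut sh F θ hP g₀ os).T (crOfRecord₁₃VAt K₀ jcut sh F θ hP g₀ os).A
      (crOfRecord₁₃VAt K₀ jcut sh F θ hP g₀ os).B (crOfRecord₁₃VAt K₀ jcut sh F θ hP g₀ os).shA (crOfRecord₁₃VAt K₀ jcut sh F θ hP g₀ os).shB
      (crOfRecord₁₃VAt K₀ jcut sh F θ hP g₀ os).Wsh := by
  letI : ∀ Kc, DecidableEq (SiteSeqKey F Kc) := fun _ => Classical.decEq _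
  refine shellWeightBound_crOfRecord₁₃VAt_optShell_of_keyReading_of_fibreDev K₀ kr θ hP g₀ os jcut sh c hsh hw0 hws
    (fun K => add_nonneg (sub_nonneg.mpr (inv_le_one_of_one_le₀ (hM K))) (hW.nonneg K)) (hMs.add hW.summable) hmA hmB ?_ ?_
  · intro K t ht
    exact fibreDevA_record_le_of_ratioOsc_of_relWeightBound K₀ kr bd θ hP g₀ os (hM K) ht hW (hBpos K t ht) (hosc K t ht)
  · intro K t ht
    refine fibreDevB_record_le_of_ratioOsc_of_relWeightBound K₀ kr bd θ hP g₀ os (hM K) ht hW (hApos K t ht) fun u hu x hx x' hx' => ?_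
    have h := hosc K t ht u hu x' hx' x hx
    linarith [h]

end Record

/-! ## §3 (v1.1, APPEND-ONLY) The window budget pays (Osc)'s summability row: `M_K := e^{2·vol·wb_K}` with module 12's window budget `wb` -/

section WindowBudget

/-- `1 − (e^{x})⁻¹ ≤ x` for every real `x` (`1 − x ≤ e^{−x}`, `Real.add_one_le_exp`). [folklore] -/
theorem one_sub_inv_exp_le (x : ℝ) : 1 - (Real.exp x)⁻¹ ≤ x := by
  have h := Real.add_one_le_exp (-x)
  rw [Real.exp_neg] at h
  linarith

/-- `0 ≤ 1 − (e^{x})⁻¹` for `0 ≤ x`. [folklore] -/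
theorem one_sub_inv_exp_nonneg {x : ℝ} (hx : 0 ≤ x) : 0 ≤ 1 - (Real.exp x)⁻¹ :=
  sub_nonneg.mpr (inv_le_one_of_one_le₀ (Real.one_le_exp hx))

/-- **★ THE OSCILLATION DEFECT OF `M_K := e^{a·b_K}` IS SUMMABLE when `b ≥ 0` is summable and `a ≥ 0`** (comparison `1 − M_K⁻¹ ≤ a·b_K`) — the `hMs` row of §2's
composition from a summable log-oscillation radius. [folklore] -/
theorem summable_one_sub_inv_exp_mul {a : ℝ} {b : ℕ → ℝ} (ha : 0 ≤ a) (hb0 : ∀ K, 0 ≤ b K) (hb : Summable b) :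
    Summable (fun K => 1 - (Real.exp (a * b K))⁻¹) :=
  Summable.of_nonneg_of_le (fun K => one_sub_inv_exp_nonneg (mul_nonneg ha (hb0 K))) (fun _ => one_sub_inv_exp_le _) (hb.mul_left a)

/-- **★★ THE WINDOW BUDGET PAYS (Osc)'s SUMMABILITY**: if the two-run log-ratio oscillation inside the good window classes is `≤ 2·vol·wb_K` with `wb_K = C·θ^K·Σ_{m ≤ j⋆K} (L⁴∕θ)^m`
this lineage's module 12 window budget (`…N20WindowKeyBudget.summable_windowBudget_of_fraction`: summable under the card's `FractionCondition`; spelled inline there and here,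
no `def`), then with `M_K := e^{2·vol·wb_K}` (`ratioOsc_of_logOsc`) BOTH rows `1 ≤ M_K` and `Summable (1 − M_K⁻¹)` of
`shellWeightBound_crOfRecord₁₃VAt_optShell_of_keyReading_of_ratioOsc_of_relWeightBound` hold — the crux card's (YG) radius feeds §2 by name.  (YG) itself NOT PRINTED, NOT proved.
[cite: Balaban1989LargeFieldII, (1.80) p.384 (the window; bookkeeping only)] [bookkeeping] -/
theorem oscRows_of_summable_windowBudget {vol C L θ : ℝ} (jstar : ℕ → ℕ) (hvol : 0 ≤ vol) (hC : 0 ≤ C) (hθ : 0 < θ)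
    (hwb : Summable (fun K : ℕ => C * θ ^ K * ∑ m ∈ range (jstar K + 1), (L ^ 4 / θ) ^ m)) :
    (∀ K : ℕ, 1 ≤ Real.exp (2 * vol * (C * θ ^ K * ∑ m ∈ range (jstar K + 1), (L ^ 4 / θ) ^ m))) ∧
      Summable (fun K : ℕ => 1 - (Real.exp (2 * vol * (C * θ ^ K * ∑ m ∈ range (jstar K + 1), (L ^ 4 / θ) ^ m)))⁻¹) := by
  have hb0 : ∀ K : ℕ, 0 ≤ C * θ ^ K * ∑ m ∈ range (jstar K + 1), (L ^ 4 / θ) ^ m := fun K =>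
    mul_nonneg (mul_nonneg hC (pow_nonneg hθ.le K)) (Finset.sum_nonneg fun m _ => pow_nonneg (div_nonneg (by positivity) hθ.le) m)
  exact ⟨fun K => Real.one_le_exp (mul_nonneg (by positivity) (hb0 K)), summable_one_sub_inv_exp_mul (by positivity) hb0 hwb⟩

end WindowBudget

end Summit.QuantumFields.YangMills.BalabanUVNodes.N20CoreEdgeShellDialAscentFromOscillation

end
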